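import Literature.NumberTheory.EllipticCurves.RootNumberAtkinLehnerSemistableProofs
import Literature.NumberTheory.EllipticCurves.AtkinLehnerInvolutionsNewformProofs
import HarnessLib

/-!
# `w(E/ℚ) = −∏_p w_p(E)` from modularity and Kellock–Dokchitser's Remark 2.2 alone

A `…Proofs` sibling (theorems only) closing the classical side of the decomposition of the named fact
`WeierstrassCurve.rootNumber_eq_algebraicRootNumber` (`RootNumber.lean`; Deligne 1973, Rohrlich 1994 §20,
Kellock–Dokchitser 2023 Def. 2.1): with Atkin–Lehner's theorem now proved in the tree
(`IsNewform0.exists_atkinLehnerInvolutionAt_eq_smul_holds`,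
`IsNewform0.frickeEigenvalue_eq_prod_atkinLehnerEigenvalueAt_holds`, `AtkinLehnerInvolutionsNewformProofs`
and `AtkinLehnerProductProofs`; Knapp 1993, Thm. 9.27(b),(c)), the local product formula `ε(f_E) = ∏ᶠ_v w_v(E)` and the root number formula follow
from the Modularity Theorem and the single deep named fact F1 =
`WeierstrassCurve.atkinLehnerEigenvalueAt_eq_localRootNumberAt` (Kellock–Dokchitser 2023, Rem. 2.2: the
local root number at `p ∣ N_E` is the Atkin–Lehner eigenvalue at `p` — local Langlands for `GL₂`; a
theorem of the tree at the primes `p ∥ N_E`, `atkinLehnerEigenvalueAt_eq_localRootNumberAt_of_not_sq_dvd`).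
**Trust base of `rootNumber_eq_algebraicRootNumber` in the tree after this file:
{`exists_isNewformOf` (BCDT 2001, Thm. A), F1}; for semistable curves {`exists_isNewformOf`}**
(`rootNumber_eq_algebraicRootNumber_of_squarefree`).

## References

* [KellockDokchitser2023] L. Cowland Kellock, V. Dokchitser, Bull. LMS 55 (2023), Def. 2.1, Rem. 2.2.
* [Knapp1993] A. W. Knapp, *Elliptic curves* (1993), Thm. 9.27.
* [BCDTJAMS2001] Breuil–Conrad–Diamond–Taylor, JAMS 14 (2001), Thm. A, Thm. B.
* [Rohrlich1994CRM] D. Rohrlich, CRM Proc. Lecture Notes 4 (1994), §§19–20 (not held).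
-/

noncomputable section

open scoped MatrixGroups

open CongruenceSubgroup Literature.NumberTheory.EllipticCurves.ModularForms IsDedekindDomain
  Literature.NumberTheory.Automorphic.BCDT

namespace WeierstrassCurve

variable (W : WeierstrassCurve ℚ)

/-- **The local product formula for the Fricke sign from Kellock–Dokchitser's Remark 2.2 alone**: the
named fact `W.frickeEigenvalue_eq_finprod_localRootNumberAt` (`ε(f) = ∏ᶠ_v w_v(E)` for the newform `f`
of an elliptic `W` with no additive reduction above `2, 3`) from F1, Atkin–Lehner's `ε(f) = ∏ λ(Q_p)`
being a theorem (`IsNewform0.frickeEigenvalue_eq_prod_atkinLehnerEigenvalueAt_holds`; Knapp 1993,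
Thm. 9.27(c)). [cite: KellockDokchitser2023, Rem. 2.2] [cite: Knapp1993, Thm. 9.27(c)] -/
theorem frickeEigenvalue_eq_finprod_localRootNumberAt_of_localRootNumberAt
    (hF1 : W.atkinLehnerEigenvalueAt_eq_localRootNumberAt) :
    W.frickeEigenvalue_eq_finprod_localRootNumberAt :=
  W.frickeEigenvalue_eq_finprod_localRootNumberAt_of_atkinLehner
    IsNewform0.frickeEigenvalue_eq_prod_atkinLehnerEigenvalueAt_holds hF1

/-- **`w(E/ℚ) = −∏_p w_p(E)` from the Modularity Theorem and Kellock–Dokchitser's Remark 2.2.** The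
named fact `W.rootNumber_eq_algebraicRootNumber` (Deligne 1973; Rohrlich 1994, §20; Kellock–Dokchitser
2023, Def. 2.1) from `exists_isNewformOf` (BCDT 2001, Thm. A; Diamond–Shurman Thm. 8.8.3) and F1 =
`atkinLehnerEigenvalueAt_eq_localRootNumberAt` (Rem. 2.2; deep only at the additive primes `p² ∣ N_E`):
Hecke's functional equation, Atkin–Lehner's Thm. 9.27(b),(c) and the multiplicative primes of Rem. 2.2
are theorems of the tree. [cite: KellockDokchitser2023, Def. 2.1 and Rem. 2.2] [cite: BCDTJAMS2001, Theorem A] -/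
theorem rootNumber_eq_algebraicRootNumber_of_exists_isNewformOf_of_localRootNumberAt
    (hmod : exists_isNewformOf) (hF1 : W.atkinLehnerEigenvalueAt_eq_localRootNumberAt) :
    W.rootNumber_eq_algebraicRootNumber :=
  W.rootNumber_eq_algebraicRootNumber_of_exists_atkinLehnerInvolutionAt_eq_smul hmod
    IsNewform0.exists_atkinLehnerInvolutionAt_eq_smul_holds hF1

/-- **`w(E/ℚ) = −∏_p w_p(E)` from BCDT Theorem B, CDT Theorem 7.2.4 and Kellock–Dokchitser's
Remark 2.2**: trust base {BCDT Thm. B, CDT Thm. 7.2.4, F1} of `rootNumber_eq_algebraicRootNumber` in the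
tree. [cite: BCDTJAMS2001, Theorem 2.2.2 and Theorem A] [cite: KellockDokchitser2023, Def. 2.1 and Rem. 2.2] -/
theorem rootNumber_eq_algebraicRootNumber_of_theoremB_of_CDT_of_localRootNumberAt (hB : theoremB)
    (hCDT : CDT_theorem_7_2_4) (hF1 : W.atkinLehnerEigenvalueAt_eq_localRootNumberAt) :
    W.rootNumber_eq_algebraicRootNumber :=
  W.rootNumber_eq_algebraicRootNumber_of_exists_isNewformOf_of_localRootNumberAt
    (exists_isNewformOf_of_theoremB_of_CDT hB hCDT) hF1

/-- **`Λ(E, 2 − s) = −∏_p w_p(E) · Λ(E, s)`** for an elliptic `W / ℚ` with no additive reduction above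
`2, 3`, from the Modularity Theorem and F1 (Kellock–Dokchitser 2023, Def. 2.1 and Rem. 2.2; Knapp 1993,
Thm. 9.8 and Thm. 9.27). [cite: KellockDokchitser2023, Def. 2.1 and Rem. 2.2] [cite: Knapp1993, Thm. 9.8 and Thm. 9.27] -/
theorem hasFunctionalEquationSign_algebraicRootNumber_of_localRootNumberAt (hmod : exists_isNewformOf)
    (hF1 : W.atkinLehnerEigenvalueAt_eq_localRootNumberAt) [W.IsElliptic]
    (h23 : ∀ v : HeightOneSpectrum ℤ, W.HasAdditiveReductionAt v → 3 < ringChar (ℤ ⧸ v.asIdeal)) :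
    W.HasFunctionalEquationSign W.algebraicRootNumber :=
  W.hasFunctionalEquationSign_algebraicRootNumber_of_atkinLehner hmod
    IsNewform0.frickeEigenvalue_eq_prod_atkinLehnerEigenvalueAt_holds hF1 h23

end WeierstrassCurve

end
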